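import Summits.CriticalPhenomena.PercolationContinuityZ3.Theorems.Transplant.BccSlabStackedB
import HarnessLib

/-!
# The bcc (001)-slabs, exit-form routing certificate X: the STACKED TEMPLATE, height difference at least four (`E₂` four or more layers above `E₁`)

builds on p205010 (kernel theorem, internal audit signed; external expert review pending) — NOT used in this file.
Lane `prim-bschramm`, seat `prim-bschramm-p2` (gen 46; class C1b, METHOD = input substitution; memo `HOME/bschramm/P2-LATTICES.md` §156); helper file
(`--supports stmt-CriticalPhenomena-4575 --as helper`).
Frame `(A; μ, ν)` with columns `a = (0,0)`, `s = (1,0)`, `u = (0,1)`, `d = (1,1)`, `d' = (1,2)`; `E₁ = (a, h₁)`, `E₂ = (a, h₂)`, `h₂ ≥ h₁ + 4`, `w' = (s, h')`.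
THE TEMPLATE (validated exhaustively for `k ≤ 9` outside Lean): hub `c = (u, h₁+1)`, `y = (a, h₁+2)`, `b = (d, h₁+2)`;
* routing 1: chain = the zigzag `a/u` from `E₁` to `E₂` (contains `c → y`); branch = `b`, a monotone `d/d'` connector to `(d, h'∓1)`, then `w'`;
* routing 2: chain = `E₁, c, b`, the zigzag `d/u` up to `(u, h₂−1)`, `E₂`; branch from `y` to `w'` in one of four regimes (`h' = h₁+1`: one step; `h' ≤ h₁−1`:
  `y, (s,h₁+1)`, then `d/s` down; `h₁+3 ≤ h' ≤ h₂−1`: `a/s` up; `h' ≥ h₂+1`: `a/s` up to `(s,h₂−1)`, then `d/s` up).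
Main result **`Frame.stacked_swapPair_ge4`**.
[cite: DuminilCopinSidoraviciusTassion2016, §2.3 (proof of Fact 2: the three disjoint paths)]
-/

noncomputable section

namespace Summit.CriticalPhenomena.PercolationContinuityZ3.Theorems.Transplant

namespace BccClawX

namespace Frame

open Literature.Probability.Percolation Literature.Probability.LatticeModels SimpleGraph BccSlab
open scoped Classical

variable {k : ℕ} {RP : Set (Site 2)} {A : Site 2} {μ ν : Pt} (F : Frame RP A μ ν)
include F

/-- A zigzag between two patch columns: its vertices lie over those columns, at heights in the zigzag's range, and in `W`. [folklore] -/
theorem zig_ctrl {W : Set (bslab k)} (hW : ∀ x : bslab k, sh x ∈ RP → x ∈ W) {i j i' j' : ℤ}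
    (hc : (i' = i ∧ (j' = j + 1 ∨ j = j' + 1)) ∨ (j' = j ∧ (i' = i + 1 ∨ i = i' + 1))) (hij : 0 ≤ i ∧ i ≤ 1 ∧ 0 ≤ j ∧ j ≤ 2)
    (hij' : 0 ≤ i' ∧ i' ≤ 1 ∧ 0 ≤ j' ∧ j' ≤ 2) {t : ℤ} {n : ℕ} (ha : Adm k (fcol A μ ν i j) t) (hend : 0 ≤ t + 1 * n ∧ t + 1 * n ≤ k) :
    ∀ x ∈ zig k (fcol A μ ν i j) (fcol A μ ν i' j') t 1 n,
      ((sh x = fcol A μ ν i j ∨ sh x = fcol A μ ν i' j') ∧ t ≤ ht x ∧ ht x ≤ t + n) ∧ x ∈ W := by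
  intro x hx
  obtain ⟨hcol, l, hl, hhl⟩ := sh_ht_of_mem_zig (Or.inl rfl) (F.fcol_adj hc) ha hend hx
  have hl' : (l : ℤ) ≤ n := by exact_mod_cast hl
  refine ⟨⟨hcol, by omega, by omega⟩, hW x ?_⟩
  rcases hcol with h | h <;> rw [h]
  · exact F.hreg i j hij.1 hij.2.1 hij.2.2.1 hij.2.2.2
  · exact F.hreg i' j' hij'.1 hij'.2.1 hij'.2.2.1 hij'.2.2.2

/-- Two frame vertices with controlled columns and heights are different when no column/height combination matches. [folklore] -/
theorem ne_of_ctrl {x y : bslab k} {i j i' j' p q p' q' : ℤ} (hx : sh x = fcol A μ ν i j ∨ sh x = fcol A μ ν i' j')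
    (hy : sh y = fcol A μ ν p q ∨ sh y = fcol A μ ν p' q')
    (h : ∀ a b : ℤ, ((a = i ∧ b = j) ∨ (a = i' ∧ b = j')) → ((a = p ∧ b = q) ∨ (a = p' ∧ b = q')) → ht x ≠ ht y) : x ≠ y := by
  rintro rfl
  have key : ∀ {a b a' b' : ℤ}, sh x = fcol A μ ν a b → sh x = fcol A μ ν a' b' → a = a' ∧ b = b' := by
    intro a b a' b' h1 h2; exact fcol_inj F.hμ F.hν F.hperp (h1.symm.trans h2)
  rcases hx with hx | hx <;> rcases hy with hy | hy
  · obtain ⟨e1, e2⟩ := key hx hy; exact h i j (Or.inl ⟨rfl, rfl⟩) (Or.inl ⟨e1, e2⟩) rfl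
  · obtain ⟨e1, e2⟩ := key hx hy; exact h i j (Or.inl ⟨rfl, rfl⟩) (Or.inr ⟨e1, e2⟩) rfl
  · obtain ⟨e1, e2⟩ := key hx hy; exact h i' j' (Or.inr ⟨rfl, rfl⟩) (Or.inl ⟨e1, e2⟩) rfl
  · obtain ⟨e1, e2⟩ := key hx hy; exact h i' j' (Or.inr ⟨rfl, rfl⟩) (Or.inr ⟨e1, e2⟩) rfl

/-- **THE STACKED TEMPLATE FOR `h₂ ≥ h₁ + 4`** (`k ≥ 3`; any admissible exit height `h'` over `s`). [cite: DuminilCopinSidoraviciusTassion2016, §2.3 (proof of Fact 2)] -/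
theorem stacked_swapPair_ge4 {WR W : Set (bslab k)} (hWR : ∀ x : bslab k, sh x ∈ RP → x ∈ WR) (hWRW : WR ⊆ W) {h₁ h₂ h' : ℤ}
    (hA : Adm k A h₁) (hA₂ : Adm k A h₂) (h4 : h₁ + 4 ≤ h₂) (hS : Adm k (fcol A μ ν 1 0) h') :
    ∃ r₁ r₂ : VRouteData (slabGraph k) WR W (fv k A μ ν 0 0 h₁) (fv k A μ ν 0 0 h₂) (fv k A μ ν 1 0 h'), r₁.y = r₂.b ∧ r₁.b = r₂.y := by
  have hW : ∀ x : bslab k, sh x ∈ RP → x ∈ W := fun x hx => hWRW (hWR x hx)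
  have h0 := hA.1
  have hk₂ := hA₂.2.1
  -- parities
  have hpar₂ : Even (h₂ - h₁) := by
    obtain ⟨m, hm⟩ := hA.2.2; obtain ⟨m', hm'⟩ := hA₂.2.2; exact ⟨m - m', by omega⟩
  obtain ⟨m₂, hm₂⟩ := hpar₂
  have hpar' : Even (1 + 0 + (h' - h₁)) := by
    obtain ⟨m, hm⟩ := hA.2.2; obtain ⟨m', hm'⟩ := hS.2.2
    rw [fcol_sum] at hm'
    rcases unit_sum F.hμ with e | e <;> rw [e] at hm'
    · exact ⟨m - m' + 1, by omega⟩
    · exact ⟨m - m', by omega⟩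
  obtain ⟨m', hm'⟩ := hpar'
  have hS0 := hS.1
  have hSk := hS.2.1
  -- admissibility helper
  have adm : ∀ (i j h m : ℤ), i + j + (h - h₁) = 2 * m → 0 ≤ h → h ≤ k → Adm k (fcol A μ ν i j) h := fun i j h m hm h0' hk' => F.adm' hA i j h m hm h0' hk'
  have aE₁ : Adm k (fcol A μ ν 0 0) h₁ := adm 0 0 h₁ 0 (by ring) h0 (by omega)
  have aE₂ : Adm k (fcol A μ ν 0 0) h₂ := adm 0 0 h₂ m₂ (by omega) (by omega) hk₂
  have ac : Adm k (fcol A μ ν 0 1) (h₁ + 1) := adm 0 1 (h₁ + 1) 1 (by ring) (by omega) (by omega)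
  have ay : Adm k (fcol A μ ν 0 0) (h₁ + 2) := adm 0 0 (h₁ + 2) 1 (by ring) (by omega) (by omega)
  have ab : Adm k (fcol A μ ν 1 1) (h₁ + 2) := adm 1 1 (h₁ + 2) 2 (by ring) (by omega) (by omega)
  have hE : fv k A μ ν 0 0 h₁ ≠ fv k A μ ν 0 0 h₂ := fun e => by
    have := (F.fv_inj (i := 0) (j := 0) (h := h₁) (i' := 0) (j' := 0) (h' := h₂) aE₁ aE₂ e).2.2; omega
  -- the zigzag numbers
  obtain ⟨n, hn⟩ : ∃ n : ℕ, (n : ℤ) = h₂ - h₁ := ⟨(h₂ - h₁).toNat, by rw [Int.toNat_of_nonneg]; omega⟩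
  obtain ⟨mm, hmm⟩ : ∃ mm : ℕ, n = mm + 2 + 2 := ⟨n - 4, by omega⟩
  have hadj_au : (zdGraph 2).Adj (fcol A μ ν 0 0) (fcol A μ ν 0 1) := F.fcol_adj (Or.inl ⟨rfl, Or.inl rfl⟩)
  have hadj_du : (zdGraph 2).Adj (fcol A μ ν 1 1) (fcol A μ ν 0 1) := F.fcol_adj (Or.inr ⟨rfl, Or.inr rfl⟩)
  -- chain 1: the zigzag a/u from E₁ to E₂
  have hend₁ : 0 ≤ h₁ + 1 * n ∧ h₁ + 1 * n ≤ k := by omega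
  have hZ₁ := gpath_zig (k := k) (Or.inl rfl) hadj_au aE₁ hend₁
  have hcol₁ : zcol (fcol A μ ν 0 0) (fcol A μ ν 0 1) n = fcol A μ ν 0 0 := by
    obtain ⟨q, hq⟩ := Int.eq_ofNat_of_zero_le (show 0 ≤ m₂ by omega)
    have hnq : n = 2 * q := by have : (n : ℤ) = ((2 * q : ℕ) : ℤ) := by push_cast; omega
                               exact_mod_cast this
    rw [hnq, zcol_two_mul]
  rw [hcol₁, show h₁ + 1 * (n : ℤ) = h₂ by omega] at hZ₁
  have hZ₁' : GPath (slabGraph k) (zig k (fcol A μ ν 0 0) (fcol A μ ν 0 1) h₁ 1 n) (fv k A μ ν 0 0 h₁) (fv k A μ ν 0 0 h₂) := hZ₁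
  have hz₁ : zig k (fcol A μ ν 0 0) (fcol A μ ν 0 1) h₁ 1 n =
      fv k A μ ν 0 0 h₁ :: fv k A μ ν 0 1 (h₁ + 1) :: zig k (fcol A μ ν 0 0) (fcol A μ ν 0 1) (h₁ + 2) 1 (mm + 2) := by
    rw [hmm]
    show vtx k _ h₁ :: vtx k _ (h₁ + 1) :: zig k _ _ (h₁ + 1 + 1) 1 (mm + 2) = _
    rw [show h₁ + 1 + 1 = h₁ + 2 by ring]; rfl
  have hZ₁ctrl := F.zig_ctrl hW (i := 0) (j := 0) (i' := 0) (j' := 1) (Or.inl ⟨rfl, Or.inl rfl⟩) (by omega) (by omega) aE₁ hend₁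
  -- chain 2: E₁, c, zigzag d/u from (d, h₁+2) to (u, h₂-1), E₂
  obtain ⟨n₂, hn₂⟩ : ∃ n₂ : ℕ, (n₂ : ℤ) = h₂ - h₁ - 3 := ⟨(h₂ - h₁ - 3).toNat, by rw [Int.toNat_of_nonneg]; omega⟩
  have hend₂ : 0 ≤ h₁ + 2 + 1 * n₂ ∧ h₁ + 2 + 1 * n₂ ≤ k := by omega
  have hZ₂ := gpath_zig (k := k) (Or.inl rfl) hadj_du ab hend₂
  have hcol₂ : zcol (fcol A μ ν 1 1) (fcol A μ ν 0 1) n₂ = fcol A μ ν 0 1 := by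
    obtain ⟨q, hq⟩ := Int.eq_ofNat_of_zero_le (show 0 ≤ m₂ - 2 by omega)
    have hnq : n₂ = 2 * q + 1 := by have : (n₂ : ℤ) = ((2 * q + 1 : ℕ) : ℤ) := by push_cast; omega
                                    exact_mod_cast this
    rw [hnq, zcol_two_mul_add_one]
  rw [hcol₂, show h₁ + 2 + 1 * (n₂ : ℤ) = h₂ - 1 by omega] at hZ₂
  have hZ₂ctrl := F.zig_ctrl hW (i := 1) (j := 1) (i' := 0) (j' := 1) (Or.inr ⟨rfl, Or.inr rfl⟩) (by omega) (by omega) ab hend₂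
  have aU : Adm k (fcol A μ ν 0 1) (h₂ - 1) := adm 0 1 (h₂ - 1) m₂ (by omega) (by omega) (by omega)
  have hT₂ : GPath (slabGraph k) (zig k (fcol A μ ν 1 1) (fcol A μ ν 0 1) (h₁ + 2) 1 n₂ ++ [fv k A μ ν 0 0 h₂]) (fv k A μ ν 1 1 (h₁ + 2))
      (fv k A μ ν 0 0 h₂) := by
    have := hZ₂.trans (GPath.pair (F.fv_adj aU aE₂ (Or.inl ⟨rfl, Or.inr rfl⟩) (Or.inl (by ring)))) ?_
    · simpa [fv] using this
    · intro x hx hxz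
      simp only [List.mem_cons, List.not_mem_nil, or_false] at hx
      rcases hx with rfl | rfl
      · rfl
      · exfalso
        obtain ⟨⟨hcol, -, -⟩, -⟩ := hZ₂ctrl _ hxz
        rcases hcol with h | h <;> rw [sh_fv aE₂] at h <;> have := fcol_inj F.hμ F.hν F.hperp h <;> omega
  have hcT₂ : fv k A μ ν 0 1 (h₁ + 1) ∉ zig k (fcol A μ ν 1 1) (fcol A μ ν 0 1) (h₁ + 2) 1 n₂ ++ [fv k A μ ν 0 0 h₂] := by
    intro h
    rcases List.mem_append.1 h with h | h
    · obtain ⟨⟨-, hlo, -⟩, -⟩ := hZ₂ctrl _ h; rw [ht_fv ac] at hlo; omega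
    · rw [List.mem_singleton] at h; have := (F.fv_inj ac aE₂ h).1; have := (F.fv_inj ac aE₂ h).2.1; omega
  have hC₂' : GPath (slabGraph k) (fv k A μ ν 0 1 (h₁ + 1) :: (zig k (fcol A μ ν 1 1) (fcol A μ ν 0 1) (h₁ + 2) 1 n₂ ++ [fv k A μ ν 0 0 h₂]))
      (fv k A μ ν 0 1 (h₁ + 1)) (fv k A μ ν 0 0 h₂) := by
    exact hT₂.cons (F.fv_adj ac ab (Or.inr ⟨rfl, Or.inl rfl⟩) (Or.inl (by ring))) hcT₂
  have hE₁C₂ : fv k A μ ν 0 0 h₁ ∉ fv k A μ ν 0 1 (h₁ + 1) :: (zig k (fcol A μ ν 1 1) (fcol A μ ν 0 1) (h₁ + 2) 1 n₂ ++ [fv k A μ ν 0 0 h₂]) := by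
    intro h
    rcases List.mem_cons.1 h with h | h
    · have := (F.fv_inj aE₁ ac h).2.1; omega
    · rcases List.mem_append.1 h with h | h
      · obtain ⟨⟨hcol, -, -⟩, -⟩ := hZ₂ctrl _ h
        rcases hcol with h | h <;> rw [sh_fv aE₁] at h <;> have := fcol_inj F.hμ F.hν F.hperp h <;> omega
      · rw [List.mem_singleton] at h; exact hE h
  have hC₂ := hC₂'.cons (F.fv_adj aE₁ ac (Or.inl ⟨rfl, Or.inl rfl⟩) (Or.inl rfl)) hE₁C₂
  -- membership control of chain 2
  have memC₂ : ∀ x ∈ fv k A μ ν 0 0 h₁ :: fv k A μ ν 0 1 (h₁ + 1) :: (zig k (fcol A μ ν 1 1) (fcol A μ ν 0 1) (h₁ + 2) 1 n₂ ++ [fv k A μ ν 0 0 h₂]),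
      x ∈ WR ∧ ((sh x = fcol A μ ν 0 0 ∧ (ht x = h₁ ∨ ht x = h₂)) ∨ (sh x = fcol A μ ν 0 1 ∧ ht x = h₁ + 1) ∨
        ((sh x = fcol A μ ν 1 1 ∨ sh x = fcol A μ ν 0 1) ∧ h₁ + 2 ≤ ht x ∧ ht x ≤ h₂ - 1)) := by
    intro x hx
    rcases List.mem_cons.1 hx with rfl | hx
    · exact ⟨hWR _ (by rw [sh_fv aE₁]; exact F.hreg 0 0 le_rfl zero_le_one le_rfl (by norm_num)), Or.inl ⟨sh_fv aE₁, Or.inl (ht_fv aE₁)⟩⟩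
    rcases List.mem_cons.1 hx with rfl | hx
    · exact ⟨hWR _ (by rw [sh_fv ac]; exact F.hreg 0 1 le_rfl zero_le_one zero_le_one (by norm_num)), Or.inr (Or.inl ⟨sh_fv ac, ht_fv ac⟩)⟩
    rcases List.mem_append.1 hx with hx | hx
    · obtain ⟨⟨hcol, hlo, hhi⟩, -⟩ := hZ₂ctrl _ hx
      refine ⟨hWR _ ?_, Or.inr (Or.inr ⟨hcol, hlo, by omega⟩)⟩
      rcases hcol with h | h <;> rw [h]
      · exact F.hreg 1 1 zero_le_one le_rfl zero_le_one (by norm_num)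
      · exact F.hreg 0 1 le_rfl zero_le_one zero_le_one (by norm_num)
    · rw [List.mem_singleton] at hx; subst hx
      exact ⟨hWR _ (by rw [sh_fv aE₂]; exact F.hreg 0 0 le_rfl zero_le_one le_rfl (by norm_num)), Or.inl ⟨sh_fv aE₂, Or.inr (ht_fv aE₂)⟩⟩
  -- membership control of chain 1
  have memC₁ : ∀ x ∈ zig k (fcol A μ ν 0 0) (fcol A μ ν 0 1) h₁ 1 n,
      x ∈ WR ∧ (sh x = fcol A μ ν 0 0 ∨ sh x = fcol A μ ν 0 1) ∧ h₁ ≤ ht x ∧ ht x ≤ h₂ := by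
    intro x hx
    obtain ⟨⟨hcol, hlo, hhi⟩, -⟩ := hZ₁ctrl _ hx
    refine ⟨hWR _ ?_, hcol, hlo, by omega⟩
    rcases hcol with h | h <;> rw [h]
    · exact F.hreg 0 0 le_rfl zero_le_one le_rfl (by norm_num)
    · exact F.hreg 0 1 le_rfl zero_le_one zero_le_one (by norm_num)
  -- branch 1: b, monotone d/d' to (d, t*), then w'
  set tS : ℤ := if h₁ + 2 < h' then h' - 1 else h' + 1 with htS
  have htS' : (h₁ + 2 < h' ∧ tS = h' - 1) ∨ (h' < h₁ + 2 ∧ tS = h' + 1) := by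
    rw [htS]; split_ifs with hlt
    · exact Or.inl ⟨hlt, rfl⟩
    · exact Or.inr ⟨by omega, rfl⟩
  have atS : Adm k (fcol A μ ν 1 1) tS := by
    rcases htS' with ⟨hlt, e⟩ | ⟨hlt, e⟩ <;> rw [e]
    · exact adm 1 1 (h' - 1) m' (by omega) (by omega) (by omega)
    · exact adm 1 1 (h' + 1) (m' + 1) (by omega) (by omega) (by omega)
  obtain ⟨L₁, hL₁G, hL₁⟩ := F.exists_mono (i := 1) (j := 1) (i' := 1) (j' := 2) (Or.inl ⟨rfl, Or.inl rfl⟩) ab (p := 1) (q := 1) (Or.inl ⟨rfl, rfl⟩) atS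
  have hwL₁ : fv k A μ ν 1 0 h' ∉ L₁ := by
    intro h; rcases (hL₁ _ h).1 with e | e <;> rw [sh_fv hS] at e <;> have := fcol_inj F.hμ F.hν F.hperp e <;> omega
  have hBr₁ : GPath (slabGraph k) (L₁ ++ [fv k A μ ν 1 0 h']) (fv k A μ ν 1 1 (h₁ + 2)) (fv k A μ ν 1 0 h') := by
    have := hL₁G.trans (GPath.pair (F.fv_adj atS hS (Or.inl ⟨rfl, Or.inr rfl⟩) (by rcases htS' with ⟨-, e⟩ | ⟨-, e⟩ <;> rw [e] <;> omega))) ?_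
    · simpa using this
    · intro x hx hxL
      simp only [List.mem_cons, List.not_mem_nil, or_false] at hx
      rcases hx with rfl | rfl
      · rfl
      · exact absurd hxL hwL₁
  -- routing 1
  obtain ⟨r₁, h1y, h1b⟩ := VRouteData.exists_ofPaths' (WR := WR) (W := W) (c := fv k A μ ν 0 1 (h₁ + 1)) (y := fv k A μ ν 0 0 (h₁ + 2)) hZ₁' hE
    (fun x hx => (memC₁ x hx).1)
    ⟨[fv k A μ ν 0 0 h₁], (zig k (fcol A μ ν 0 0) (fcol A μ ν 0 1) (h₁ + 2) 1 (mm + 2)).tail, by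
      rw [hz₁]
      have hZy := gpath_zig (k := k) (n := mm + 2) (Or.inl rfl) hadj_au ay (by push_cast; omega)
      conv_lhs => rw [hZy.eq_cons]
      rfl⟩
    hBr₁
    (by
      intro x hx
      rcases List.mem_append.1 hx with h | h
      · exact F.ctrl_mem hW hL₁ (by omega) (by omega) x h
      · rw [List.mem_singleton] at h; subst h; exact hW _ (by rw [sh_fv hS]; exact F.hreg 1 0 zero_le_one le_rfl le_rfl (by norm_num)))
    (F.fv_adj ac ab (Or.inr ⟨rfl, Or.inl rfl⟩) (Or.inl (by ring)))
    (by
      intro x hx hxC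
      obtain ⟨-, hcolC, -, -⟩ := memC₁ x hxC
      rcases List.mem_append.1 hx with h | h
      · obtain ⟨hcolL, -, -⟩ := hL₁ x h
        exact F.ne_of_ctrl hcolL hcolC (fun a b h1 h2 _ => by rcases h1 with ⟨rfl, rfl⟩ | ⟨rfl, rfl⟩ <;> rcases h2 with ⟨h2, h2'⟩ | ⟨h2, h2'⟩ <;> omega) rfl
      · rw [List.mem_singleton] at h; subst h
        rcases hcolC with e | e <;> rw [sh_fv hS] at e <;> have := fcol_inj F.hμ F.hν F.hperp e <;> omega)
  -- branch 2 from y to w', by regimes; packaged as an existence statement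
  have hBr₂ : ∃ Br : List (bslab k), GPath (slabGraph k) Br (fv k A μ ν 0 0 (h₁ + 2)) (fv k A μ ν 1 0 h') ∧ (∀ x ∈ Br, x ∈ W) ∧
      ∀ x ∈ Br, x ∉ fv k A μ ν 0 0 h₁ :: fv k A μ ν 0 1 (h₁ + 1) :: (zig k (fcol A μ ν 1 1) (fcol A μ ν 0 1) (h₁ + 2) 1 n₂ ++ [fv k A μ ν 0 0 h₂]) := by
    -- a vertex with known column class and height range off the chain
    have off : ∀ (x : bslab k) (i j i' j' lo hi : ℤ), (sh x = fcol A μ ν i j ∨ sh x = fcol A μ ν i' j') → lo ≤ ht x → ht x ≤ hi →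
        (∀ t : ℤ, lo ≤ t → t ≤ hi → (((i = 0 ∧ j = 0) ∨ (i' = 0 ∧ j' = 0)) → t ≠ h₁ ∧ t ≠ h₂) ∧ (((i = 0 ∧ j = 1) ∨ (i' = 0 ∧ j' = 1)) → t ≠ h₁ + 1) ∧
          (((i = 1 ∧ j = 1) ∨ (i' = 1 ∧ j' = 1) ∨ (i = 0 ∧ j = 1) ∨ (i' = 0 ∧ j' = 1)) → ¬ (h₁ + 2 ≤ t ∧ t ≤ h₂ - 1))) →
        x ∉ fv k A μ ν 0 0 h₁ :: fv k A μ ν 0 1 (h₁ + 1) :: (zig k (fcol A μ ν 1 1) (fcol A μ ν 0 1) (h₁ + 2) 1 n₂ ++ [fv k A μ ν 0 0 h₂]) := by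
      intro x i j i' j' lo hi hcol hlo hhi hav hx
      obtain ⟨-, hC⟩ := memC₂ x hx
      have key : ∀ {a b a' b' : ℤ}, sh x = fcol A μ ν a b → sh x = fcol A μ ν a' b' → a = a' ∧ b = b' := by
        intro a b a' b' h1 h2; exact fcol_inj F.hμ F.hν F.hperp (h1.symm.trans h2)
      obtain ⟨hv1, hv2, hv3⟩ := hav (ht x) hlo hhi
      rcases hC with ⟨hs, hh⟩ | ⟨hs, hh⟩ | ⟨hs, hh⟩
      · rcases hcol with hc | hc <;> obtain ⟨e1, e2⟩ := key hc hs
        · exact hh.elim (hv1 (Or.inl ⟨e1, e2⟩)).1 (hv1 (Or.inl ⟨e1, e2⟩)).2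
        · exact hh.elim (hv1 (Or.inr ⟨e1, e2⟩)).1 (hv1 (Or.inr ⟨e1, e2⟩)).2
      · rcases hcol with hc | hc <;> obtain ⟨e1, e2⟩ := key hc hs
        · exact hv2 (Or.inl ⟨e1, e2⟩) hh
        · exact hv2 (Or.inr ⟨e1, e2⟩) hh
      · rcases hcol with hc | hc <;> rcases hs with hs | hs <;> obtain ⟨e1, e2⟩ := key hc hs
        · exact hv3 (Or.inl ⟨e1, e2⟩) hh
        · exact hv3 (Or.inr (Or.inr (Or.inl ⟨e1, e2⟩))) hh
        · exact hv3 (Or.inr (Or.inl ⟨e1, e2⟩)) hh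
        · exact hv3 (Or.inr (Or.inr (Or.inr ⟨e1, e2⟩))) hh
    have aS1 : Adm k (fcol A μ ν 1 0) (h₁ + 1) := adm 1 0 (h₁ + 1) 1 (by ring) (by omega) (by omega)
    by_cases hR1 : h' = h₁ + 1
    · -- regime 1: one step
      subst hR1
      refine ⟨[fv k A μ ν 0 0 (h₁ + 2), fv k A μ ν 1 0 (h₁ + 1)], GPath.pair (F.fv_adj ay hS (Or.inr ⟨rfl, Or.inl rfl⟩) (Or.inr (by ring))), ?_, ?_⟩
      · intro x hx; simp only [List.mem_cons, List.not_mem_nil, or_false] at hx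
        rcases hx with rfl | rfl
        · exact hW _ (by rw [sh_fv ay]; exact F.hreg 0 0 le_rfl zero_le_one le_rfl (by norm_num))
        · exact hW _ (by rw [sh_fv hS]; exact F.hreg 1 0 zero_le_one le_rfl le_rfl (by norm_num))
      · intro x hx; simp only [List.mem_cons, List.not_mem_nil, or_false] at hx
        rcases hx with rfl | rfl
        · exact off _ 0 0 0 0 (h₁ + 2) (h₁ + 2) (Or.inl (sh_fv ay)) (by rw [ht_fv ay]) (by rw [ht_fv ay]) (by intro t h1 h2; refine ⟨?_, ?_, ?_⟩ <;> intro <;> omega)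
        · exact off _ 1 0 1 0 (h₁ + 1) (h₁ + 1) (Or.inl (sh_fv hS)) (by rw [ht_fv hS]) (by rw [ht_fv hS]) (by intro t h1 h2; refine ⟨?_, ?_, ?_⟩ <;> intro <;> omega)
    by_cases hR2 : h' ≤ h₁ - 1
    · -- regime 2: y, (s, h₁+1), then d/s downwards from (d, h₁) to w'
      have ad0 : Adm k (fcol A μ ν 1 1) h₁ := adm 1 1 h₁ 1 (by ring) h0 (by omega)
      obtain ⟨L, hLG, hL⟩ := F.exists_mono (i := 1) (j := 1) (i' := 1) (j' := 0) (Or.inl ⟨rfl, Or.inr rfl⟩) ad0 (p := 1) (q := 0) (Or.inr ⟨rfl, rfl⟩) hS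
      have hs1L : fv k A μ ν 1 0 (h₁ + 1) ∉ L := by intro h; have := (hL _ h).2.2; rw [ht_fv aS1] at this; rw [max_eq_left (by omega)] at this; omega
      have hG' := hLG.cons (F.fv_adj aS1 ad0 (Or.inl ⟨rfl, Or.inl rfl⟩) (Or.inr (by ring))) hs1L
      have hyL : fv k A μ ν 0 0 (h₁ + 2) ∉ fv k A μ ν 1 0 (h₁ + 1) :: L := by
        intro h; rcases List.mem_cons.1 h with h | h
        · have := (F.fv_inj ay aS1 h).1; omega
        · have := (hL _ h).2.2; rw [ht_fv ay] at this; rw [max_eq_left (by omega)] at this; omega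
      refine ⟨_, hG'.cons (F.fv_adj ay aS1 (Or.inr ⟨rfl, Or.inl rfl⟩) (Or.inr (by ring))) hyL, ?_, ?_⟩
      · intro x hx
        rcases List.mem_cons.1 hx with rfl | hx
        · exact hW _ (by rw [sh_fv ay]; exact F.hreg 0 0 le_rfl zero_le_one le_rfl (by norm_num))
        rcases List.mem_cons.1 hx with rfl | hx
        · exact hW _ (by rw [sh_fv aS1]; exact F.hreg 1 0 zero_le_one le_rfl le_rfl (by norm_num))
        · exact F.ctrl_mem hW hL (by omega) (by omega) x hx
      · intro x hx
        rcases List.mem_cons.1 hx with rfl | hx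
        · exact off _ 0 0 0 0 (h₁ + 2) (h₁ + 2) (Or.inl (sh_fv ay)) (by rw [ht_fv ay]) (by rw [ht_fv ay]) (by intro t h1 h2; refine ⟨?_, ?_, ?_⟩ <;> intro <;> omega)
        rcases List.mem_cons.1 hx with rfl | hx
        · exact off _ 1 0 1 0 (h₁ + 1) (h₁ + 1) (Or.inl (sh_fv aS1)) (by rw [ht_fv aS1]) (by rw [ht_fv aS1])
            (by intro t h1 h2; refine ⟨?_, ?_, ?_⟩ <;> intro <;> omega)
        · obtain ⟨hcol, hlo, hhi⟩ := hL x hx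
          rw [min_eq_right (by omega), max_eq_left (by omega)] at *
          exact off _ 1 1 1 0 h' h₁ hcol hlo hhi (by intro t h1 h2; refine ⟨?_, ?_, ?_⟩ <;> intro <;> omega)
    by_cases hR3 : h' ≤ h₂ - 1
    · -- regime 3: a/s upwards from y to w'
      obtain ⟨L, hLG, hL⟩ := F.exists_mono (i := 0) (j := 0) (i' := 1) (j' := 0) (Or.inr ⟨rfl, Or.inl rfl⟩) ay (p := 1) (q := 0) (Or.inr ⟨rfl, rfl⟩) hS
      refine ⟨L, hLG, F.ctrl_mem hW hL (by omega) (by omega), fun x hx => ?_⟩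
      obtain ⟨hcol, hlo, hhi⟩ := hL x hx
      rw [min_eq_left (by omega), max_eq_right (by omega)] at *
      exact off _ 0 0 1 0 (h₁ + 2) h' hcol hlo hhi (by intro t h1 h2; refine ⟨?_, ?_, ?_⟩ <;> intro <;> omega)
    · -- regime 4: a/s up to (s, h₂ - 1), then d/s up from (d, h₂) to w'
      have aS2 : Adm k (fcol A μ ν 1 0) (h₂ - 1) := adm 1 0 (h₂ - 1) m₂ (by omega) (by omega) (by omega)
      have aD2 : Adm k (fcol A μ ν 1 1) h₂ := adm 1 1 h₂ (m₂ + 1) (by omega) (by omega) hk₂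
      obtain ⟨L, hLG, hL⟩ := F.exists_mono (i := 0) (j := 0) (i' := 1) (j' := 0) (Or.inr ⟨rfl, Or.inl rfl⟩) ay (p := 1) (q := 0) (Or.inr ⟨rfl, rfl⟩) aS2
      obtain ⟨L', hL'G, hL'⟩ := F.exists_mono (i := 1) (j := 1) (i' := 1) (j' := 0) (Or.inl ⟨rfl, Or.inr rfl⟩) aD2 (p := 1) (q := 0) (Or.inr ⟨rfl, rfl⟩) hS
      have hjL' : fv k A μ ν 1 0 (h₂ - 1) ∉ L' := by
        intro h; have := (hL' _ h).2.1; rw [ht_fv aS2, min_eq_left (by omega)] at this; omega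
      have hG2 := hL'G.cons (F.fv_adj aS2 aD2 (Or.inl ⟨rfl, Or.inl rfl⟩) (Or.inl (by ring))) hjL'
      have hG := hLG.trans hG2 (by
        intro x hx hxL
        rcases List.mem_cons.1 hx with rfl | hx
        · rfl
        · exfalso
          have h1 := (hL _ hxL).2.2; have h2 := (hL' _ hx).2.1
          rw [max_eq_right (by omega)] at h1; rw [min_eq_left (by omega)] at h2; omega)
      refine ⟨_, hG, ?_, ?_⟩
      · intro x hx
        rcases List.mem_append.1 hx with hx | hx
        · exact F.ctrl_mem hW hL (by omega) (by omega) x hx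
        · exact F.ctrl_mem hW hL' (by omega) (by omega) x (by simpa using hx)
      · intro x hx
        rcases List.mem_append.1 hx with hx | hx
        · obtain ⟨hcol, hlo, hhi⟩ := hL x hx
          rw [min_eq_left (by omega), max_eq_right (by omega)] at *
          exact off _ 0 0 1 0 (h₁ + 2) (h₂ - 1) hcol hlo hhi (by intro t h1 h2; refine ⟨?_, ?_, ?_⟩ <;> intro <;> omega)
        · obtain ⟨hcol, hlo, hhi⟩ := hL' x (by simpa using hx)
          rw [min_eq_left (by omega), max_eq_right (by omega)] at *
          exact off _ 1 1 1 0 h₂ h' hcol hlo hhi (by intro t h1 h2; refine ⟨?_, ?_, ?_⟩ <;> intro <;> omega)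
  obtain ⟨Br₂, hBr₂G, hBr₂W, hBr₂off⟩ := hBr₂
  -- routing 2
  obtain ⟨r₂, h2y, h2b⟩ := VRouteData.exists_ofPaths' (WR := WR) (W := W) (c := fv k A μ ν 0 1 (h₁ + 1)) (y := fv k A μ ν 1 1 (h₁ + 2)) hC₂ hE
    (fun x hx => (memC₂ x hx).1)
    ⟨[fv k A μ ν 0 0 h₁], (zig k (fcol A μ ν 1 1) (fcol A μ ν 0 1) (h₁ + 2) 1 n₂).tail ++ [fv k A μ ν 0 0 h₂], by
      conv_lhs => rw [hZ₂.eq_cons]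
      simp [fv]⟩
    hBr₂G hBr₂W
    (F.fv_adj ac ay (Or.inl ⟨rfl, Or.inr rfl⟩) (Or.inl (by ring)))
    hBr₂off
  refine ⟨r₁, r₂, ?_, ?_⟩
  · rw [h1y, h2b]
  · rw [h1b, h2y]

end Frame

end BccClawX

end Summit.CriticalPhenomena.PercolationContinuityZ3.Theorems.Transplant

end
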